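import Summits.NavierStokesRegularity.NavierStokesRegularity.Theorems.ScenarioCensusRowF1PincerKill
import Summits.NavierStokesRegularity.NavierStokesRegularity.Theorems.ScenarioCensusRowF1PincerRows
import HarnessLib

/-!
# LINE 25 «eulerian-pincer» port, part 4/4: §8 (cont.) both rows are EXCLUDED (`rowF1ie_holds`, `rowF1if_holds`), the floors (THE PINCER), `pincerSlack_iff_rowF1`, ancient displays,
# corollaries (the sign row «EBBING TOP», eventual threshold rows); census KEYS `Row_F1ie` / `Row_F1if` + `_excluded`, floors DE / DF

Re-homed for the scenario census (typer seat ns-census-typer-1 g9; the cells F1ie / F1if and the floors DE / DF are MEMBERS OF RECORD «DECIDED IN KERNEL IN FILES» of row F1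
since census v1.77 (critic backstop idea-crit-7 PASS 03:14Z; ref ns-census-ref g10 PRE-CHECK ✓ §15.17 item 41; lead-presearch label); this port makes them TREE-decided):
VERBATIM PORT of the NEW declarations (§1 read-outs, §6 kill, §8 rows) of ns-idea-3 LINE 25 «eulerian-pincer»,
`pub/ideators/ns-idea-3/lines/eulerian-pincer/line-eulerian-pincer.lean` sha16 b2a1952cbeded9c7 (1972 l., lean check rc 0, 0 sorry; the frame of §1, §2–§5 and §7 are
shared VERBATIM with LINES 18/20/22/24/27 and taken BY NAME from the landed ports — not re-declared), split for the 400-line rule into `ScenarioCensusRowF1Pincer` (§1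
read-outs) → `…PincerKill` (§6) → `…PincerRows` (§8 numbers/rows) → `…PincerTop` (§8 verdicts + census KEYS).  Lean text VERBATIM in namespace
`…Theorems.ScenarioCensus.EulerianPincer` (the line's `…Cruxes.ScenarioCensusRowF1.EulerianPincerLine` re-homed), shared names spelled by namespace (`LiouvilleSocket.…`
frame / τ-tool, `FrozenTop.…`, `InviscidTop.…`, `IntegratedStretch.…`, …); port edits: the bracket lines `section …` / `end …` dropped (no `variable`s), `@[conjecture]`
on the residual `PincerSlack` (≡ `ScenarioCensus.Row_F1`, OPEN), one-line docstrings added where missing (gate lint).  Statements untouched.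

No census VALUE is moved here (row F1 stays OPEN-WITH-LINE; the members become TREE-decided by name); NS regularity is NOT proved; `Row_F1` is untouched (zero
movement, `pincerSlack_iff_rowF1`); no summit statement is proved by this file.
-/

-- the summit and its single problem share the name `NavierStokesRegularity` (D-0017 nested layout)
set_option linter.dupNamespace false

noncomputable section

open MeasureTheory Set Function Filter TopologicalSpace Metric
open scoped Topology NNReal ENNReal InnerProductSpace RealInnerProductSpace Laplacian

namespace Summit.NavierStokesRegularity.NavierStokesRegularity.Theorems.ScenarioCensus.EulerianPincer

open Literature.Analysis Literature.Analysis.FluidPDE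
open Summit.NavierStokesRegularity.NavierStokesRegularity.Theorems

/-! ### Both rows are EXCLUDED; the floors (THE PINCER); the residual ≡ `Row_F1` -/

/-- **Criterion row F1ie is EXCLUDED** (in kernel).  Engine: singular zoom at a non-extendable point
(`FrozenTop.exists_singularZoom_package₃`) → the time-dependent INTEGRAL TRANSFER `LiouvilleSocket.integral_transfer₆τ` gives
`⟪ω̃, ∂ₛω̃⟫ − θ|ω̃|²/(−s) ≤ 0` wherever `W ≠ 0` → analytic globalisation (`FrozenTop.jointCond_everywhere₄`) → EVERYWHERE on the
open past → THE KILL `eq_zero_of_ebbing` (`θ < 1`) → `W ≡ 0`, contradicting non-triviality of the zoom limit. -/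
theorem rowF1ie_holds : Row_F1ie := by
  intro ν T hν hT u p hsol hLH hdec hTI htop
  obtain ⟨θ, t₀, Λ, hθ, ht₀, ht₀T, hΛ, hΛm, hfinP⟩ := htop
  obtain ⟨M, hM⟩ := LiouvilleSocket.exists_isTypeIBlowupWith hν hTI
  have hfin : ∫⁻ z, LiouvilleSocket.topIntegrandτ T ν t₀ Λ (fun τ v L H K => ebbOf θ τ v L H K) u z < ⊤ := by
    rw [lintegral_topIntegrandτ_ebbOf_eq hν hT hsol ht₀ θ Λ]
    exact ENNReal.mul_lt_top ENNReal.ofReal_lt_top hfinP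
  apply hasSmoothExtensionPast_of_forall_exists_parabolicCylinder hν hT hsol hLH hdec
  intro x₀
  by_contra hno
  obtain ⟨α, β, R, c, W, hα, hβ, hR, hαR, hαν, hcpos, hclim, hW, hpt, hgrad, hhess, hlap, t, ht, y, hne⟩ :=
    FrozenTop.exists_singularZoom_package₃ hν hT hsol hLH hdec hM x₀ (InviscidTop.sing_of_not_bounded hno)
  have hRd := LiouvilleSocket.integral_transfer₆τ hν hsol hW ht₀ ht₀T hα hβ hαR hαν hcpos hclim hpt hgrad hhess hlap
    (Rd := fun τ v L H K => ebbOf θ τ v L H K) (continuousOn_ebbOf θ)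
    (fun a ha τ hτ v L H K => ebbOf_smul ha hτ θ v L H K) hΛ hΛm hfin
  have hall := FrozenTop.jointCond_everywhere₄ hW (P := fun w q => ebbOf θ (-w) q.1 q.2.1 q.2.2.1 q.2.2.2 ≤ 0)
    (fun w => isClosed_le (continuous_ebbOf_fixed θ (-w)) continuous_const)
    (fun w => by show ebbOf θ (-w) 0 0 0 0 ≤ 0; rw [ebbOf_zero]) hRd
  refine hne (eq_zero_of_ebbing hθ hW (fun s hs y' => ?_) t ht y)
  have hb := hall s hs y'
  rw [ebbOf_slice hW θ (-s) hs y'] at hb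
  linarith

/-- **Criterion row F1if is EXCLUDED** (in kernel): same engine with the read-out `flareOf κ`; the kill is
`eq_zero_of_flaring` (`κ > 1`). -/
theorem rowF1if_holds : Row_F1if := by
  intro ν T hν hT u p hsol hLH hdec hTI htop
  obtain ⟨κ, t₀, Λ, hκ, ht₀, ht₀T, hΛ, hΛm, hfinP⟩ := htop
  obtain ⟨M, hM⟩ := LiouvilleSocket.exists_isTypeIBlowupWith hν hTI
  have hfin : ∫⁻ z, LiouvilleSocket.topIntegrandτ T ν t₀ Λ (fun τ v L H K => flareOf κ τ v L H K) u z < ⊤ := by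
    rw [lintegral_topIntegrandτ_flareOf_eq hν hT hsol ht₀ κ Λ]
    exact ENNReal.mul_lt_top ENNReal.ofReal_lt_top hfinP
  apply hasSmoothExtensionPast_of_forall_exists_parabolicCylinder hν hT hsol hLH hdec
  intro x₀
  by_contra hno
  obtain ⟨α, β, R, c, W, hα, hβ, hR, hαR, hαν, hcpos, hclim, hW, hpt, hgrad, hhess, hlap, t, ht, y, hne⟩ :=
    FrozenTop.exists_singularZoom_package₃ hν hT hsol hLH hdec hM x₀ (InviscidTop.sing_of_not_bounded hno)
  have hRd := LiouvilleSocket.integral_transfer₆τ hν hsol hW ht₀ ht₀T hα hβ hαR hαν hcpos hclim hpt hgrad hhess hlap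
    (Rd := fun τ v L H K => flareOf κ τ v L H K) (continuousOn_flareOf κ)
    (fun a ha τ hτ v L H K => flareOf_smul ha hτ κ v L H K) hΛ hΛm hfin
  have hall := FrozenTop.jointCond_everywhere₄ hW (P := fun w q => flareOf κ (-w) q.1 q.2.1 q.2.2.1 q.2.2.2 ≤ 0)
    (fun w => isClosed_le (continuous_flareOf_fixed κ (-w)) continuous_const)
    (fun w => by show flareOf κ (-w) 0 0 0 0 ≤ 0; rw [flareOf_zero]) hRd
  refine hne (eq_zero_of_flaring hκ hW (fun s hs y' => ?_) t ht y)
  have hb := hall s hs y'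
  rw [flareOf_slice hW κ (-s) hs y'] at hb
  linarith

/-- **The floor DIVERGENT EBB-EXCESS holds.** -/
theorem divergentEbbExcess_holds : DivergentEbbExcess := by
  intro ν T hν hT u p hmax hLH hdec hTI θ hθ t₀ ht₀ ht₀T Λ hΛ hΛm
  by_contra hne
  exact hmax.2 (rowF1ie_holds ν T hν hT u p hmax.1 hLH hdec hTI
    ⟨θ, t₀, Λ, hθ, ht₀, ht₀T, hΛ, hΛm, lt_top_iff_ne_top.2 hne⟩)

/-- **The floor DIVERGENT FLARE-DEFICIT holds.** -/
theorem divergentFlareDeficit_holds : DivergentFlareDeficit := by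
  intro ν T hν hT u p hmax hLH hdec hTI κ hκ t₀ ht₀ ht₀T Λ hΛ hΛm
  by_contra hne
  exact hmax.2 (rowF1if_holds ν T hν hT u p hmax.1 hLH hdec hTI
    ⟨κ, t₀, Λ, hκ, ht₀, ht₀T, hΛ, hΛm, lt_top_iff_ne_top.2 hne⟩)

/-- **THE EULERIAN PINCER** (structural theorem, maximal frame): for a maximal Type-I Clay blow-up, on the fast set of
EVERY measurable subcritical speed level and on every `[t₀, T)`, the fixed-point rate `½∂ₜ|ω|²` of the enstrophy
density BOTH exceeds every fraction `θ < 1` of the self-similar rate `|ω|²/(T − t)` NON-INTEGRABLY (against `√(T − t)`)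
AND falls short of every multiple `κ > 1` of it NON-INTEGRABLY.  PROVED. -/
theorem eulerianPincer_holds : DivergentEbbExcess ∧ DivergentFlareDeficit :=
  ⟨divergentEbbExcess_holds, divergentFlareDeficit_holds⟩

/-- The residual is EXACTLY row F1 (declared; no movement on `Row_F1` is claimed). -/
theorem pincerSlack_iff_rowF1 : PincerSlack ↔ ScenarioCensus.Row_F1 :=
  ⟨rowF1_of rowF1ie_holds rowF1if_holds, pincerSlack_of_rowF1⟩

/-- Row F1 from the residual alone (both criterion rows being proved). -/
theorem rowF1_of_pincerSlack (h : PincerSlack) : ScenarioCensus.Row_F1 :=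
  rowF1_of rowF1ie_holds rowF1if_holds h

/-! ### Ancient displays of the kill -/

/-- **EULERIAN-EBBING TYPE-I ANCIENT SOLUTIONS ARE TRIVIAL** (`θ < 1`; `∂ₛω̃` written out). -/
theorem ebbing_ancient_trivial {C θ : ℝ} (hθ : θ < 1) {W : ℝ → LiouvilleSocket.E3 → LiouvilleSocket.E3} (hW : IsTypeIAncientMild C W)
    (h : ∀ s < (0 : ℝ), ∀ y : LiouvilleSocket.E3,
      ⟪curl (W s) y, (Δ (curl (W s))) y - convect (W s) (curl (W s)) y + convect (curl (W s)) (W s) y⟫ ≤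
        θ * ((-s)⁻¹ * ‖curl (W s) y‖ ^ 2)) :
    ∀ s < (0 : ℝ), ∀ y : LiouvilleSocket.E3, W s y = 0 :=
  eq_zero_of_ebbing hθ hW h

/-- The sign case `θ = 0`: a `𝒦` whose enstrophy density is non-increasing IN TIME AT EVERY FIXED POINT is trivial. -/
theorem eulerianNonIncreasing_ancient_trivial {C : ℝ} {W : ℝ → LiouvilleSocket.E3 → LiouvilleSocket.E3} (hW : IsTypeIAncientMild C W)
    (h : ∀ s < (0 : ℝ), ∀ y : LiouvilleSocket.E3,
      ⟪curl (W s) y, (Δ (curl (W s))) y - convect (W s) (curl (W s)) y + convect (curl (W s)) (W s) y⟫ ≤ 0) :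
    ∀ s < (0 : ℝ), ∀ y : LiouvilleSocket.E3, W s y = 0 :=
  eq_zero_of_ebbing zero_lt_one hW fun s hs y => by
    rw [zero_mul]
    exact h s hs y

/-- **EULERIAN-FLARING TYPE-I ANCIENT SOLUTIONS ARE TRIVIAL** (`κ > 1`). -/
theorem flaring_ancient_trivial {C κ : ℝ} (hκ : 1 < κ) {W : ℝ → LiouvilleSocket.E3 → LiouvilleSocket.E3} (hW : IsTypeIAncientMild C W)
    (h : ∀ s < (0 : ℝ), ∀ y : LiouvilleSocket.E3, κ * ((-s)⁻¹ * ‖curl (W s) y‖ ^ 2) ≤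
      ⟪curl (W s) y, (Δ (curl (W s))) y - convect (W s) (curl (W s)) y + convect (curl (W s)) (W s) y⟫) :
    ∀ s < (0 : ℝ), ∀ y : LiouvilleSocket.E3, W s y = 0 :=
  eq_zero_of_flaring hκ hW h

/-! ### Corollaries in kernel: the sign row «EBBING TOP» and the eventual threshold rows on both sides -/

/-- **EBBING TOP** (sign row, `θ = 0`; parameter-free): Type I + at some measurable subcritical level and some
`t₀ ∈ [0, T)`, the enstrophy density of the fast fluid is NON-INCREASING IN TIME AT EVERY FIXED FAST POINT
(`⟪ω, ∂ₜω⟫ = ½∂ₜ|ω|² ≤ 0` at every `Λ`-fast point of `[t₀, T) × ℝ³`) ⇒ smooth extension.  The number vanishes. -/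
theorem rowF1_ebbingTop : ∀ (ν T : ℝ), 0 < ν → 0 < T → ∀ (u : ℝ → LiouvilleSocket.E3 → LiouvilleSocket.E3) (p : ℝ → LiouvilleSocket.E3 → ℝ),
    IsClassicalNSSolutionOn (Ico 0 T) ν 0 u p → IsLerayHopfOn T ν 0 (u 0) u →
    HasRapidSpatialDecay (u 0) → IsTypeIBlowup u T →
    (∃ (t₀ : ℝ) (Λ : ℝ → ℝ), 0 ≤ t₀ ∧ t₀ < T ∧ LiouvilleSocket.IsSubcriticalLevel T Λ ∧ Measurable Λ ∧
      ∀ t ∈ Ico t₀ T, ∀ x, Λ t < ‖u t x‖ →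
        ⟪curl (u t) x, timeDerivWithin (Ico 0 T) (vorticity u) t x⟫ ≤ 0) →
    HasSmoothExtensionPast ν 0 u T := by
  intro ν T hν hT u p hsol hLH hdec hTI htop
  obtain ⟨t₀, Λ, ht₀, ht₀T, hΛ, hΛm, hsign⟩ := htop
  refine rowF1ie_holds ν T hν hT u p hsol hLH hdec hTI ⟨0, t₀, Λ, zero_lt_one, ht₀, ht₀T, hΛ, hΛm, ?_⟩
  have h0 : ∀ z, ebbIntegrand T 0 t₀ Λ u z = 0 := by
    intro z
    unfold ebbIntegrand
    by_cases hz : z ∈ {z : ℝ × LiouvilleSocket.E3 | z.1 ∈ Ico t₀ T ∧ Λ z.1 < ‖u z.1 z.2‖}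
    · rw [indicator_of_mem hz, zero_mul, sub_zero, max_eq_left (hsign z.1 hz.1 z.2 hz.2), mul_zero,
        ENNReal.ofReal_zero]
    · rw [indicator_of_notMem hz]
  rw [lintegral_congr h0, lintegral_zero]
  exact ENNReal.zero_lt_top

/-- **EVENTUAL SUB-SELF-SIMILAR EULERIAN RATE** (threshold row): Type I + for some `θ < 1` and some measurable subcritical
level, EVENTUALLY `(T − t) ⟪ω, ∂ₜω⟫ ≤ θ |ω|²` at every fast point ⇒ smooth extension (the ebb integrand vanishes on
`[t₀, T)` for `t₀` inside the window). -/
theorem rowF1_ebbThreshold : ∀ (ν T : ℝ), 0 < ν → 0 < T → ∀ (u : ℝ → LiouvilleSocket.E3 → LiouvilleSocket.E3) (p : ℝ → LiouvilleSocket.E3 → ℝ),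
    IsClassicalNSSolutionOn (Ico 0 T) ν 0 u p → IsLerayHopfOn T ν 0 (u 0) u →
    HasRapidSpatialDecay (u 0) → IsTypeIBlowup u T →
    (∃ (θ : ℝ) (Λ : ℝ → ℝ), θ < 1 ∧ LiouvilleSocket.IsSubcriticalLevel T Λ ∧ Measurable Λ ∧
      ∀ᶠ t in 𝓝[<] T, ∀ x : LiouvilleSocket.E3, Λ t < ‖u t x‖ →
        (T - t) * ⟪curl (u t) x, timeDerivWithin (Ico 0 T) (vorticity u) t x⟫ ≤ θ * ‖curl (u t) x‖ ^ 2) →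
    HasSmoothExtensionPast ν 0 u T := by
  intro ν T hν hT u p hsol hLH hdec hTI htop
  obtain ⟨θ, Λ, hθ, hΛ, hΛm, hev⟩ := htop
  obtain ⟨t₁, ht₁T, hsub⟩ := (mem_nhdsLT_iff_exists_Ioo_subset).1 hev
  have ht₁T' : t₁ < T := ht₁T
  set t₀ : ℝ := max 0 ((t₁ + T) / 2) with ht₀def
  have ht₀ : 0 ≤ t₀ := le_max_left _ _
  have ht₀T : t₀ < T := max_lt hT (by linarith)
  have hzero : ∀ z, ebbIntegrand T θ t₀ Λ u z = 0 := by
    intro z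
    by_cases hz : z ∈ {z : ℝ × LiouvilleSocket.E3 | z.1 ∈ Ico t₀ T ∧ Λ z.1 < ‖u z.1 z.2‖}
    · rw [ebbIntegrand, indicator_of_mem hz]
      have hσ : 0 < T - z.1 := sub_pos.2 hz.1.2
      have ht1 : t₁ < z.1 := by
        have : (t₁ + T) / 2 ≤ z.1 := (le_max_right _ _).trans hz.1.1
        linarith
      have hmem : z.1 ∈ {t : ℝ | ∀ x : LiouvilleSocket.E3, Λ t < ‖u t x‖ →
          (T - t) * ⟪curl (u t) x, timeDerivWithin (Ico 0 T) (vorticity u) t x⟫ ≤ θ * ‖curl (u t) x‖ ^ 2} :=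
        hsub ⟨ht1, hz.1.2⟩
      have hP : (T - z.1) * ⟪curl (u z.1) z.2, timeDerivWithin (Ico 0 T) (vorticity u) z.1 z.2⟫ ≤
          θ * ‖curl (u z.1) z.2‖ ^ 2 := hmem z.2 hz.2
      have hle : ⟪curl (u z.1) z.2, timeDerivWithin (Ico 0 T) (vorticity u) z.1 z.2⟫
          - θ * ((T - z.1)⁻¹ * ‖curl (u z.1) z.2‖ ^ 2) ≤ 0 := by
        have h1 : ⟪curl (u z.1) z.2, timeDerivWithin (Ico 0 T) (vorticity u) z.1 z.2⟫ ≤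
            θ * ‖curl (u z.1) z.2‖ ^ 2 / (T - z.1) := by
          rw [le_div_iff₀ hσ]
          linarith
        have e : θ * ((T - z.1)⁻¹ * ‖curl (u z.1) z.2‖ ^ 2) = θ * ‖curl (u z.1) z.2‖ ^ 2 / (T - z.1) := by
          ring
        linarith
      rw [max_eq_left hle, mul_zero, ENNReal.ofReal_zero]
    · rw [ebbIntegrand, indicator_of_notMem hz]
  refine rowF1ie_holds ν T hν hT u p hsol hLH hdec hTI ⟨θ, t₀, Λ, hθ, ht₀, ht₀T, hΛ, hΛm, ?_⟩
  rw [lintegral_congr hzero, lintegral_zero]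
  exact ENNReal.zero_lt_top

/-- **EVENTUAL SUPER-SELF-SIMILAR EULERIAN RATE** (threshold row, the other side): Type I + for some `κ > 1` and some
measurable subcritical level, EVENTUALLY `κ |ω|² ≤ (T − t) ⟪ω, ∂ₜω⟫` at every fast point ⇒ smooth extension. -/
theorem rowF1_flareThreshold : ∀ (ν T : ℝ), 0 < ν → 0 < T → ∀ (u : ℝ → LiouvilleSocket.E3 → LiouvilleSocket.E3) (p : ℝ → LiouvilleSocket.E3 → ℝ),
    IsClassicalNSSolutionOn (Ico 0 T) ν 0 u p → IsLerayHopfOn T ν 0 (u 0) u →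
    HasRapidSpatialDecay (u 0) → IsTypeIBlowup u T →
    (∃ (κ : ℝ) (Λ : ℝ → ℝ), 1 < κ ∧ LiouvilleSocket.IsSubcriticalLevel T Λ ∧ Measurable Λ ∧
      ∀ᶠ t in 𝓝[<] T, ∀ x : LiouvilleSocket.E3, Λ t < ‖u t x‖ →
        κ * ‖curl (u t) x‖ ^ 2 ≤ (T - t) * ⟪curl (u t) x, timeDerivWithin (Ico 0 T) (vorticity u) t x⟫) →
    HasSmoothExtensionPast ν 0 u T := by
  intro ν T hν hT u p hsol hLH hdec hTI htop
  obtain ⟨κ, Λ, hκ, hΛ, hΛm, hev⟩ := htop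
  obtain ⟨t₁, ht₁T, hsub⟩ := (mem_nhdsLT_iff_exists_Ioo_subset).1 hev
  have ht₁T' : t₁ < T := ht₁T
  set t₀ : ℝ := max 0 ((t₁ + T) / 2) with ht₀def
  have ht₀ : 0 ≤ t₀ := le_max_left _ _
  have ht₀T : t₀ < T := max_lt hT (by linarith)
  have hzero : ∀ z, flareIntegrand T κ t₀ Λ u z = 0 := by
    intro z
    by_cases hz : z ∈ {z : ℝ × LiouvilleSocket.E3 | z.1 ∈ Ico t₀ T ∧ Λ z.1 < ‖u z.1 z.2‖}
    · rw [flareIntegrand, indicator_of_mem hz]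
      have hσ : 0 < T - z.1 := sub_pos.2 hz.1.2
      have ht1 : t₁ < z.1 := by
        have : (t₁ + T) / 2 ≤ z.1 := (le_max_right _ _).trans hz.1.1
        linarith
      have hmem : z.1 ∈ {t : ℝ | ∀ x : LiouvilleSocket.E3, Λ t < ‖u t x‖ →
          κ * ‖curl (u t) x‖ ^ 2 ≤ (T - t) * ⟪curl (u t) x, timeDerivWithin (Ico 0 T) (vorticity u) t x⟫} :=
        hsub ⟨ht1, hz.1.2⟩
      have hP : κ * ‖curl (u z.1) z.2‖ ^ 2 ≤
          (T - z.1) * ⟪curl (u z.1) z.2, timeDerivWithin (Ico 0 T) (vorticity u) z.1 z.2⟫ := hmem z.2 hz.2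
      have hle : κ * ((T - z.1)⁻¹ * ‖curl (u z.1) z.2‖ ^ 2)
          - ⟪curl (u z.1) z.2, timeDerivWithin (Ico 0 T) (vorticity u) z.1 z.2⟫ ≤ 0 := by
        have h1 : κ * ‖curl (u z.1) z.2‖ ^ 2 / (T - z.1) ≤
            ⟪curl (u z.1) z.2, timeDerivWithin (Ico 0 T) (vorticity u) z.1 z.2⟫ := by
          rw [div_le_iff₀ hσ]
          linarith
        have e : κ * ((T - z.1)⁻¹ * ‖curl (u z.1) z.2‖ ^ 2) = κ * ‖curl (u z.1) z.2‖ ^ 2 / (T - z.1) := by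
          ring
        linarith
      rw [max_eq_left hle, mul_zero, ENNReal.ofReal_zero]
    · rw [flareIntegrand, indicator_of_notMem hz]
  refine rowF1if_holds ν T hν hT u p hsol hLH hdec hTI ⟨κ, t₀, Λ, hκ, ht₀, ht₀T, hΛ, hΛm, ?_⟩
  rw [lintegral_congr hzero, lintegral_zero]
  exact ENNReal.zero_lt_top

end Summit.NavierStokesRegularity.NavierStokesRegularity.Theorems.ScenarioCensus.EulerianPincer

namespace Summit.NavierStokesRegularity.NavierStokesRegularity.Theorems.ScenarioCensus

/-! ## Census KEYS (ns `…Theorems.ScenarioCensus`): the EULERIAN-PINCER members of row F1 (LINE 25) — TREE-decided F1ie / F1if and floors DE / DF -/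

/-- **Cell F1ie** (sub-self-similar side: row F1 frame VERBATIM + for some `θ < 1`, `t₀`, measurable subcritical level, the EBB EXCESS of the enstrophy density of the fast fluid is integrable against `√(T−t)` ⇒ smooth extension past `T`): `:= EulerianPincer.Row_F1ie`. DECIDED. -/
def Row_F1ie : Prop := EulerianPincer.Row_F1ie
/-- F1ie is EXCLUDED (decided in the tree): `EulerianPincer.rowF1ie_holds`. -/
theorem row_F1ie_excluded : Row_F1ie := EulerianPincer.rowF1ie_holds

/-- **Cell F1if** (super-self-similar side: for some `κ > 1`, `t₀`, measurable subcritical level, the FLARE DEFICIT is integrable): `:= EulerianPincer.Row_F1if`. DECIDED. -/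
def Row_F1if : Prop := EulerianPincer.Row_F1if
/-- F1if is EXCLUDED (decided in the tree): `EulerianPincer.rowF1if_holds`. -/
theorem row_F1if_excluded : Row_F1if := EulerianPincer.rowF1if_holds

/-- **Floor DE — DIVERGENT EBB-EXCESS**: `EulerianPincer.divergentEbbExcess_holds`. -/
theorem row_F1_divergentEbbExcess : EulerianPincer.DivergentEbbExcess := EulerianPincer.divergentEbbExcess_holds
/-- **Floor DF — DIVERGENT FLARE-DEFICIT**: `EulerianPincer.divergentFlareDeficit_holds`. -/
theorem row_F1_divergentFlareDeficit : EulerianPincer.DivergentFlareDeficit := EulerianPincer.divergentFlareDeficit_holds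

end Summit.NavierStokesRegularity.NavierStokesRegularity.Theorems.ScenarioCensus

end
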